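import Summits.AnomalousDissipation.AnomalousDissipation.Theorems.BaireTransferDenseLoudDesignerForcesErgodicLine

/-!
# Sub-phases and the orbit closure of a loud trajectory (line `ergodic-budget-selection-closing`,
# crux `BaireTransfer.DenseLoudDesignerForces`, stmt-AnomalousDissipation-1143)

Sorry-free support for the TRAJECTORY form of the line's residual (skeleton v8, fourth lead c3-0, 2026-08-16), over the landed
vocabulary `…ErgodicLine.lean` (p80157):

* `IsNSPhase.of_subset` — a CLOSED FORWARD-INVARIANT subset of an NS phase is an NS phase for the same semiflow (every clause of the
  interface `IsNSPhase` restricts);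
* `IsNSPhase.orbitClosure` — in particular the closure `closure {φ_t x : t ≥ 0}` of the forward orbit of a point `x ∈ K` is an NS
  phase (forward invariance of the closure: `φ_s` is continuous on `K ⊇` the closure and maps the orbit into itself by the semigroup
  law), and `mem_orbitClosure_self` (`x = φ_0 x` lies in it);
* the registered alias `stub_orbitClosurePhase` (Stub OC of skeleton v8).
The companion file `…StubLoudInvariantMeasureOrbitClosure.lean` applies the landed Krylov–Bogolyubov stub `stub_loudInvariantMeasure`
(p109397) to this sub-phase (Stub KB′), so that the residual only has to make the chaotic hypothesis for the LOUD invariant measures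
carried by the orbit closure of the loud trajectory it produces.

References: Foias–Manley–Rosa–Temam, *Navier–Stokes Equations and Turbulence* (CUP 2001) Ch. IV §2–§3 (time-average measures of one
trajectory); N. Kryloff, N. Bogoliouboff, Ann. of Math. 38 (1937).
-/

set_option linter.dupNamespace false

noncomputable section

open scoped BigOperators Topology ENNReal InnerProductSpace
open Filter Set Function MeasureTheory

namespace Summit.AnomalousDissipation.AnomalousDissipation.Theorems.DenseLoudDesignerForces.Ergodic

open Literature.Analysis.FunctionSpaces Literature.Analysis.FunctionSpaces.Torus
open Literature.Analysis.FluidPDE Literature.Analysis.FluidPDE.Torus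
open Summit.AnomalousDissipation.AnomalousDissipation.Theses.BaireTransfer
open Summit.AnomalousDissipation.AnomalousDissipation.Theorems.DenseLoudDesignerForces.Negative

section OrbitClosure

variable {ν : ℝ} {F : (UnitAddTorus (Fin 3)) → (EuclideanSpace ℝ (Fin 3))} {K : Set Hsp} {φ : ℝ → Hsp → Hsp}

/-- **Sub-phases.**  A closed, forward-invariant subset `K₀` of an NS phase `(K, φ)` is an NS phase for the same semiflow: compactness,
the semigroup law, joint continuity, finiteness and continuity of the enstrophy and the classical trajectories all restrict.
[folklore] -/
theorem IsNSPhase.of_subset (hK : IsNSPhase ν F K φ) {K₀ : Set Hsp} (hK₀ : K₀ ⊆ K) (hcl : IsClosed K₀)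
    (hinv : ∀ t : ℝ, 0 ≤ t → MapsTo (φ t) K₀ K₀) : IsNSPhase ν F K₀ φ where
  isCompact := hK.isCompact.of_isClosed_subset hcl hK₀
  mapsTo := hinv
  map_zero x hx := hK.map_zero x (hK₀ hx)
  map_add s t hs ht x hx := hK.map_add s t hs ht x (hK₀ hx)
  continuousOn := hK.continuousOn.mono (prod_mono Subset.rfl hK₀)
  enstrophy_finite x hx := hK.enstrophy_finite x (hK₀ hx)
  enstrophy_continuousOn := hK.enstrophy_continuousOn.mono hK₀
  trajectory x hx := hK.trajectory x (hK₀ hx)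

/-- The forward orbit `{φ_t x : t ≥ 0}` of a point of `K` lies in `K`. [folklore] -/
theorem IsNSPhase.orbit_subset (hK : IsNSPhase ν F K φ) {x : Hsp} (hx : x ∈ K) :
    (fun t : ℝ => φ t x) '' Ici 0 ⊆ K := by
  rintro _ ⟨t, ht, rfl⟩
  exact hK.mapsTo t ht hx

/-- The closure of the forward orbit of a point of `K` lies in `K`. [folklore] -/
theorem IsNSPhase.orbitClosure_subset (hK : IsNSPhase ν F K φ) {x : Hsp} (hx : x ∈ K) :
    closure ((fun t : ℝ => φ t x) '' Ici 0) ⊆ K :=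
  closure_minimal (hK.orbit_subset hx) hK.isCompact.isClosed

/-- A point lies in the closure of its own forward orbit (`x = φ_0 x`). [folklore] -/
theorem IsNSPhase.mem_orbitClosure_self (hK : IsNSPhase ν F K φ) {x : Hsp} (hx : x ∈ K) :
    x ∈ closure ((fun t : ℝ => φ t x) '' Ici 0) :=
  subset_closure ⟨0, mem_Ici.2 le_rfl, hK.map_zero x hx⟩

/-- **The orbit closure is an NS phase.**  For `x ∈ K` the closure of the forward orbit `{φ_t x : t ≥ 0}` is a closed forward-invariant
subset of `K` — `φ_s` (`s ≥ 0`) is continuous on `K`, hence maps the closure of the orbit into the closure of its image, and it maps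
the orbit into itself by the semigroup law `φ_s (φ_t x) = φ_{s+t} x` — so it is an NS phase for the same semiflow. [folklore] -/
theorem IsNSPhase.orbitClosure (hK : IsNSPhase ν F K φ) {x : Hsp} (hx : x ∈ K) :
    IsNSPhase ν F (closure ((fun t : ℝ => φ t x) '' Ici 0)) φ := by
  refine hK.of_subset (hK.orbitClosure_subset hx) isClosed_closure fun s hs => ?_
  -- `φ_s` is continuous on the closure of the orbit (a subset of `K`)
  have hcs : ContinuousOn (φ s) (closure ((fun t : ℝ => φ t x) '' Ici 0)) := by
    have h0 : Continuous fun y : Hsp => ((s, y) : ℝ × Hsp) := by fun_prop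
    exact (hK.continuousOn.comp h0.continuousOn fun y hy => ⟨hs, hy⟩).mono (hK.orbitClosure_subset hx)
  -- and maps the orbit into itself
  have horb : MapsTo (φ s) ((fun t : ℝ => φ t x) '' Ici 0) ((fun t : ℝ => φ t x) '' Ici 0) := by
    rintro _ ⟨t, ht, rfl⟩
    refine ⟨s + t, mem_Ici.2 (add_nonneg hs ht), ?_⟩
    exact hK.map_add s t hs ht x hx
  intro y hy
  exact closure_mono horb.image_subset (hcs.image_closure ⟨y, hy, rfl⟩)

/-- **Stub OC of the line `ergodic-budget-selection-closing` (registered name of `IsNSPhase.orbitClosure`)**: the closure of the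
forward orbit of a point of an NS phase is an NS phase for the same semiflow. [folklore] -/
theorem stub_orbitClosurePhase {ν : ℝ} {F : (UnitAddTorus (Fin 3)) → (EuclideanSpace ℝ (Fin 3))} {K : Set Hsp}
    {φ : ℝ → Hsp → Hsp} (hK : IsNSPhase ν F K φ) {x : Hsp} (hx : x ∈ K) :
    IsNSPhase ν F (closure ((fun t : ℝ => φ t x) '' Ici 0)) φ :=
  hK.orbitClosure hx

end OrbitClosure

end Summit.AnomalousDissipation.AnomalousDissipation.Theorems.DenseLoudDesignerForces.Ergodic

end
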